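import Summits.Ventures.Crystal3D.Theorems.StickyWulffConstantGenericWallFloorDozenStep
import Summits.Ventures.Crystal3D.Theorems.StickyWulffConstantGenericWallFloorStarLemma
import HarnessLib

/-!
# A saturated hcp run-end has two unsaturated contact neighbours (the dozen step with completeness)
# (route `StickyWulffConstant`; lane T helper (L7) of cf-p1 ROUTE §83(7)(d); tool of lane G's `WallLedgerG`)

HONEST FRAMING. Part of the venture `Summits/Ventures/Crystal3D` (cell `crystal3d-full`), helper for the
crux `TextureLiminf` (stmt-Ventures-19483) of `route-Ventures-StickyWulffConstant` — cf-p1's ask (L7)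
(INBOX 2026-08-28T03:42:56Z; script HOME/cf-p1/jobs/chainj/dozenstep_hcp_exit_cases.py): the kernel-grade
corollary for the hcp «third branch» (non-exactly-capped exit) of the chain census.  Rung credit only.

* `contacts_fullShell_or_twinDozen_of_allButOne` — the dozen step `fullShell_or_twinDozen_of_allButOne`
  (`…GenericWallFloorDozenStep`, 19480-p1) WITH COMPLETENESS: under `KissingGap δ` / `KissingClassification δ`
  (by name), a ball `y` with twelve contacts, three linearly independent exact slot neighbours
  `y + A a, y + A b, y + A c ∈ X`, and all contact neighbours but at most one saturated has AS ITS CONTACT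
  SET exactly the full slot shell `y + A(fccSlots)`, or exactly a twin dozen of the grain (nine own-side
  slots `⟪A w, n⟫ ≤ 0` and the three mirror sites of the slots `⟪A w, n⟫ < 0`, for a `{111}` unit normal
  `n` with `a, b, c` own-side) — every contact of `y` is one of the listed sites.
* `hcpRunEnd_exists_unsaturated`, `hcpRunEnd_two_unsaturated` — **(L7)**: in the cubic frame of a grain
  `A` (slots `slotSite k`, cubic vectors `slotInt k /√2`), let `t` have twelve contacts, the in-plane
  predecessor `t + A·slotSite 2` (`(−1,1,0)/√2` = hex180 = `b₁ − t`), the in-plane neighbour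
  `t + A·slotSite 6` (`(−1,0,1)/√2` = hex120), the upper neighbour `t + A·slotSite 8` (`(0,1,1)/√2` =
  tri150↑ = `u↑`) and its BASAL MIRROR IMAGE `t + A·u↓`, `u↓ = (−4,−1,−1)/(3√2) = ⅓·slotSite 8 −
  ⅔·slotSite 0 − ⅔·slotSite 4` (tri150↓, the hcp site below; NOT a slot of `A`), all in `X`, and the
  forward in-plane slot `t + A·slotSite 1` (`(1,−1,0)/√2` = hex0) EMPTY (run-end).  Then `t` has two
  distinct contact neighbours with at most eleven contacts each.  Proof = cf-p1's case analysis: the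
  full shell needs hex0; a twin dozen with `a, b, c` own-side has `⟪A·hex0, n⟫ ∈ {0, √(2/3)}`; `0` again
  needs hex0; `√(2/3)` forces `u↓` to be a mirror site with `⟪A u↓, n⟫ = √(2/3)`, against
  `⟪A u↓, n⟫ = −⅓γ − ⅔⟪A·slotSite 0, n⟫ − ⅔√(2/3) ≤ ⅓√(2/3)` (`γ = ⟪A·slotSite 8, n⟫ ∈ {0, −√(2/3)}`).
  Other labellings of the exit (hex240 / tri210) are the same statement for `A` composed with a lattice
  symmetry.  As cf-p1 notes, the two unsaturated balls may be `u↑, u↓` themselves: no spare unit is claimed.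

WHAT THIS IS NOT: not a charge, not a census row, not the stub of any crux; F-C1 not moved.
-/

noncomputable section

namespace Summit.Ventures.Crystal3D.Theorems

open Summit.Ventures.Crystal3D Finset NearIdentity
open Literature.Geometry.DiscreteGeometry (fccKissingPattern hcpKissingPattern)
open scoped InnerProductSpace

variable {X : Finset (EuclideanSpace ℝ (Fin 3))}

/-! ### The dozen step with completeness -/

/-- **Dozen step with completeness.**  As `fullShell_or_twinDozen_of_allButOne`, plus: every contact of `y`
is one of the listed sites (full shell: a slot; twin dozen: an own-side slot or a mirror site). -/
theorem contacts_fullShell_or_twinDozen_of_allButOne {δ : ℝ} (hg : KissingGap δ) (hc : KissingClassification δ)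
    (hX : ∀ p ∈ X, ∀ q ∈ X, p ≠ q → 1 ≤ dist p q) {y : EuclideanSpace ℝ (Fin 3)}
    (h12 : (X.filter fun q => dist y q = 1).card = 12) (y₀ : EuclideanSpace ℝ (Fin 3))
    (hnb : ∀ z ∈ X, dist y z = 1 → z ≠ y₀ → (X.filter fun q => dist z q = 1).card = 12)
    (A : EuclideanSpace ℝ (Fin 3) ≃ₗᵢ[ℝ] EuclideanSpace ℝ (Fin 3)) {a b c : EuclideanSpace ℝ (Fin 3)}
    (ha : a ∈ fccSlots) (hb : b ∈ fccSlots) (hc' : c ∈ fccSlots) (hind : LinearIndependent ℝ ![a, b, c])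
    (haX : y + A a ∈ X) (hbX : y + A b ∈ X) (hcX : y + A c ∈ X) :
    ((∀ w ∈ fccSlots, y + A w ∈ X) ∧ ∀ q ∈ X, dist y q = 1 → ∃ w ∈ fccSlots, q = y + A w) ∨
    ∃ n : EuclideanSpace ℝ (Fin 3), ‖n‖ = 1 ∧
      (∀ w ∈ fccSlots, ⟪A w, n⟫_ℝ = 0 ∨ ⟪A w, n⟫_ℝ = Real.sqrt (2 / 3) ∨ ⟪A w, n⟫_ℝ = -Real.sqrt (2 / 3)) ∧
      (∀ w ∈ fccSlots, ⟪A w, n⟫_ℝ ≤ 0 → y + A w ∈ X) ∧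
      (∀ w ∈ fccSlots, ⟪A w, n⟫_ℝ < 0 → y + (A w - (2 * ⟪A w, n⟫_ℝ) • n) ∈ X) ∧
      (∀ w ∈ fccSlots, 0 < ⟪A w, n⟫_ℝ → y + A w ∉ X) ∧
      ⟪A a, n⟫_ℝ ≤ 0 ∧ ⟪A b, n⟫_ℝ ≤ 0 ∧ ⟪A c, n⟫_ℝ ≤ 0 ∧
      ∀ q ∈ X, dist y q = 1 →
        (∃ w ∈ fccSlots, ⟪A w, n⟫_ℝ ≤ 0 ∧ q = y + A w) ∨
        (∃ w ∈ fccSlots, ⟪A w, n⟫_ℝ < 0 ∧ q = y + (A w - (2 * ⟪A w, n⟫_ℝ) • n)) := by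
  obtain ⟨P, B, hP, hocc, hall⟩ := exists_frame_of_allButOne hg hc hX h12 y₀ hnb
  have key : ∀ w ∈ fccSlots, y + A w ∈ X →
      A w ∈ B '' (↑P : Set (EuclideanSpace ℝ (Fin 3))) := by
    intro w hw hwX
    have hd : dist y (y + A w) = 1 := by
      rw [dist_self_add_right, LinearIsometryEquiv.norm_map, norm_eq_one_of_mem_fccSlots hw]
    obtain ⟨p, hp, he⟩ := hall _ hwX hd
    exact ⟨p, Finset.mem_coe.2 hp, (add_left_cancel he).symm⟩
  have back : ∀ v ∈ B '' (↑P : Set (EuclideanSpace ℝ (Fin 3))), y + v ∈ X := by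
    rintro v ⟨p, hp, rfl⟩; exact (hocc p (Finset.mem_coe.1 hp)).1
  have compl : ∀ q ∈ X, dist y q = 1 → q - y ∈ B '' (↑P : Set (EuclideanSpace ℝ (Fin 3))) := by
    intro q hq hd
    obtain ⟨p, hp, he⟩ := hall q hq hd
    exact ⟨p, Finset.mem_coe.2 hp, by rw [he, add_sub_cancel_left]⟩
  have slotA : ∀ w ∈ fccSlots, A w ∈ A '' (↑fccSlots : Set (EuclideanSpace ℝ (Fin 3))) :=
    fun w hw => ⟨w, Finset.mem_coe.2 hw, rfl⟩
  have hind' : LinearIndependent ℝ ![A a, A b, A c] := linearIndependent_map_triple A hind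
  rcases hP with rfl | rfl
  · left
    have hEq := fccDozen_eq_slots_of_three_independent A B (key a ha haX) (key b hb hbX) (key c hc' hcX)
      (slotA a ha) (slotA b hb) (slotA c hc') hind'
    refine ⟨fun w hw => back _ (by rw [hEq]; exact slotA w hw), fun q hq hd => ?_⟩
    have hmem := compl q hq hd
    rw [hEq] at hmem
    obtain ⟨w, hw, he⟩ := hmem
    exact ⟨w, Finset.mem_coe.1 hw, by rw [he, add_sub_cancel]⟩
  · right
    obtain ⟨n, hn, hmenu, hD⟩ := hcpDozen_twin_of_three_independent A B (key a ha haX) (key b hb hbX)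
      (key c hc' hcX) (slotA a ha) (slotA b hb) (slotA c hc') hind'
    refine ⟨n, hn, hmenu, ?_, ?_, ?_, (slot_mem_twinDozen_iff A hn hmenu hD ha).1 (key a ha haX),
      (slot_mem_twinDozen_iff A hn hmenu hD hb).1 (key b hb hbX),
      (slot_mem_twinDozen_iff A hn hmenu hD hc').1 (key c hc' hcX), ?_⟩
    · intro w hw hle
      apply back; rw [hD]; exact Or.inl ⟨w, ⟨hw, hle⟩, rfl⟩
    · intro w hw hlt
      apply back; rw [hD]; exact Or.inr ⟨w, ⟨hw, hlt⟩, rfl⟩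
    · intro w hw hpos hwX
      have := (slot_mem_twinDozen_iff A hn hmenu hD hw).1 (key w hw hwX)
      linarith
    · intro q hq hd
      have hmem := compl q hq hd
      rw [hD] at hmem
      rcases hmem with ⟨w, ⟨hw, hle⟩, he⟩ | ⟨w, ⟨hw, hlt⟩, he⟩
      · have he' : A w = q - y := he
        exact Or.inl ⟨w, hw, hle, by rw [he', add_sub_cancel]⟩
      · have he' : A w - (2 * ⟪A w, n⟫_ℝ) • n = q - y := he
        exact Or.inr ⟨w, hw, hlt, by rw [he', add_sub_cancel]⟩

/-! ### The slot arithmetic of the hcp run-end -/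

/-- `hex0 = −hex180`: `slotSite 1 = −slotSite 2` (cubic `(1,−1,0)` and `(−1,1,0)`). -/
theorem slotSite_one_eq_neg_two : slotSite 1 = -slotSite 2 := by
  have h : ‖slotSite 1 + slotSite 2‖ ^ 2 = 0 := by
    rw [norm_add_sq_real, norm_eq_one_of_mem_fccSlots (slotSite_mem 1),
      norm_eq_one_of_mem_fccSlots (slotSite_mem 2), inner_slotSite]
    simp [slotInt, dotProduct, Fin.sum_univ_three]; norm_num
  have : slotSite 1 + slotSite 2 = 0 := by simpa using h
  exact eq_neg_of_add_eq_zero_left this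

/-- `slotSite 4 = slotSite 8 − slotSite 2` (cubic `(1,0,1) = (0,1,1) − (−1,1,0)`). -/
theorem slotSite_four_eq : slotSite 4 = slotSite 8 - slotSite 2 := by
  apply cubicCoords_injective
  rw [cubicCoords_sub, cubicCoords_slotSite, cubicCoords_slotSite, cubicCoords_slotSite]
  ext i
  fin_cases i <;> simp [slotVec, slotInt]
  ring

/-- The lower basal mirror of the upper slot `slotSite 8` (hcp site `tri150↓`): cubic `(−4,−1,−1)/(3√2)`. -/
theorem cubicCoords_glideDown :
    cubicCoords ((1 / 3 : ℝ) • slotSite 8 - (2 / 3 : ℝ) • slotSite 0 - (2 / 3 : ℝ) • slotSite 4) =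
      fun i => (![-4, -1, -1] : Fin 3 → ℝ) i / (3 * Real.sqrt 2) := by
  rw [cubicCoords_sub, cubicCoords_sub, cubicCoords_smul, cubicCoords_smul, cubicCoords_smul,
    cubicCoords_slotSite, cubicCoords_slotSite, cubicCoords_slotSite]
  have hs0 : Real.sqrt 2 ≠ 0 := by positivity
  ext i
  fin_cases i <;> simp [slotVec, slotInt] <;> field_simp <;> ring

/-- `u↓` is a unit vector. -/
theorem norm_glideDown :
    ‖(1 / 3 : ℝ) • slotSite 8 - (2 / 3 : ℝ) • slotSite 0 - (2 / 3 : ℝ) • slotSite 4‖ = 1 := by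
  have hs : Real.sqrt 2 ^ 2 = 2 := Real.sq_sqrt (by norm_num)
  have hs0 : Real.sqrt 2 ≠ 0 := by positivity
  have h2 : ‖(1 / 3 : ℝ) • slotSite 8 - (2 / 3 : ℝ) • slotSite 0 - (2 / 3 : ℝ) • slotSite 4‖ ^ 2 = 1 := by
    rw [norm_sq_eq_cubicCoords_sum, cubicCoords_glideDown]
    simp only [Matrix.cons_val_zero, Matrix.cons_val_one, Matrix.cons_val]
    field_simp
    rw [hs]; norm_num
  have h0 : 0 ≤ ‖(1 / 3 : ℝ) • slotSite 8 - (2 / 3 : ℝ) • slotSite 0 - (2 / 3 : ℝ) • slotSite 4‖ := norm_nonneg _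
  nlinarith [h2, h0]

/-- `⟪u↓, slotSite 8⟫ = −⅓` (the `109.47°` pair of the equatorial closed star). -/
theorem inner_glideDown_slotSite_eight :
    ⟪(1 / 3 : ℝ) • slotSite 8 - (2 / 3 : ℝ) • slotSite 0 - (2 / 3 : ℝ) • slotSite 4, slotSite 8⟫_ℝ = -(1 / 3) := by
  rw [inner_sub_left, inner_sub_left, inner_smul_left, inner_smul_left, inner_smul_left,
    real_inner_self_eq_norm_sq, norm_eq_one_of_mem_fccSlots (slotSite_mem 8), inner_slotSite, inner_slotSite]
  simp [slotInt, dotProduct, Fin.sum_univ_three]; norm_num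

/-- `u↓` is not a slot of the grain. -/
theorem glideDown_not_mem_fccSlots :
    (1 / 3 : ℝ) • slotSite 8 - (2 / 3 : ℝ) • slotSite 0 - (2 / 3 : ℝ) • slotSite 4 ∉ fccSlots := by
  intro h
  obtain ⟨k, hk⟩ := exists_slotSite_eq h
  have h1 := inner_glideDown_slotSite_eight
  rw [← hk, inner_slotSite] at h1
  have h2 : (3 * (slotInt k ⬝ᵥ slotInt 8) : ℝ) = -2 := by linarith
  have h3 : (3 * (slotInt k ⬝ᵥ slotInt 8) : ℤ) = -2 := by exact_mod_cast h2
  omega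

/-! ### (L7): a saturated hcp run-end has two unsaturated contact neighbours -/

/-- **(L7), `y₀`-form.**  See the module docstring: for every exception `y₀` there is a contact neighbour
`z ≠ y₀` of `t` with at most eleven contacts. -/
theorem hcpRunEnd_exists_unsaturated {δ : ℝ} (hg : KissingGap δ) (hc : KissingClassification δ)
    (hX : ∀ p ∈ X, ∀ q ∈ X, p ≠ q → 1 ≤ dist p q) {t : EuclideanSpace ℝ (Fin 3)}
    (h12 : (X.filter fun q => dist t q = 1).card = 12)
    (A : EuclideanSpace ℝ (Fin 3) ≃ₗᵢ[ℝ] EuclideanSpace ℝ (Fin 3))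
    (haX : t + A (slotSite 2) ∈ X) (hbX : t + A (slotSite 6) ∈ X) (hcX : t + A (slotSite 8) ∈ X)
    (hdX : t + A ((1 / 3 : ℝ) • slotSite 8 - (2 / 3 : ℝ) • slotSite 0 - (2 / 3 : ℝ) • slotSite 4) ∈ X)
    (hrun : t + A (slotSite 1) ∉ X) (y₀ : EuclideanSpace ℝ (Fin 3)) :
    ∃ z ∈ X, dist t z = 1 ∧ z ≠ y₀ ∧ (X.filter fun q => dist z q = 1).card ≤ 11 := by
  by_contra hcon
  push Not at hcon
  have hnb : ∀ z ∈ X, dist t z = 1 → z ≠ y₀ → (X.filter fun q => dist z q = 1).card = 12 := by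
    intro z hz hd hne
    have h1 := hcon z hz hd hne
    have h2 := card_filter_dist_eq_one_le_twelve X hX z
    omega
  have hind : LinearIndependent ℝ ![slotSite 2, slotSite 6, slotSite 8] :=
    linearIndependent_slotSite (by decide)
  set s := Real.sqrt (2 / 3) with hs
  have hs0 : 0 < s := Real.sqrt_pos.2 (by norm_num)
  set u : EuclideanSpace ℝ (Fin 3) :=
    (1 / 3 : ℝ) • slotSite 8 - (2 / 3 : ℝ) • slotSite 0 - (2 / 3 : ℝ) • slotSite 4 with hu
  have hdu : dist t (t + A u) = 1 := by
    rw [dist_self_add_right, LinearIsometryEquiv.norm_map, hu, norm_glideDown]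
  rcases contacts_fullShell_or_twinDozen_of_allButOne hg hc hX h12 y₀ hnb A (slotSite_mem 2) (slotSite_mem 6)
    (slotSite_mem 8) hind haX hbX hcX with ⟨hfull, -⟩ | ⟨n, hn, hmenu, hocc, hmir, -, ha, hb, hc8, hcompl⟩
  · exact hrun (hfull _ (slotSite_mem 1))
  · -- `⟪A hex0, n⟫ = −⟪A hex180, n⟫ ≥ 0`
    have h1 : ⟪A (slotSite 1), n⟫_ℝ = -⟪A (slotSite 2), n⟫_ℝ := by
      rw [slotSite_one_eq_neg_two, map_neg, inner_neg_left]
    rcases hmenu _ (slotSite_mem 1) with h0 | hpos | hneg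
    · exact hrun (hocc _ (slotSite_mem 1) h0.le)
    · -- `⟪A·slotSite 2, n⟫ = −√(2/3)`; locate `u↓` in the dozen
      have ha' : ⟪A (slotSite 2), n⟫_ℝ = -s := by linarith
      rcases hcompl _ hdX hdu with ⟨w, hw, hle, he⟩ | ⟨w, hw, hlt, he⟩
      · -- `u↓` would be a slot
        have hAu : A u = A w := add_left_cancel he
        have : u = w := A.injective hAu
        exact glideDown_not_mem_fccSlots (by rw [← hu, this]; exact hw)
      · -- `u↓` a mirror site: `⟪A u, n⟫ = √(2/3)`
        have hw' : ⟪A w, n⟫_ℝ = -s := by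
          rcases hmenu w hw with h | h | h
          · linarith
          · linarith
          · exact h
        have hAu : A u = A w - (2 * ⟪A w, n⟫_ℝ) • n := add_left_cancel he
        have hun : ⟪A u, n⟫_ℝ = s := by
          rw [hAu, inner_sub_left, inner_smul_left, real_inner_self_eq_norm_sq, hn, hw']
          simp; ring
        -- expand `⟪A u, n⟫` in the slots `8, 0, 4 = 8 − 2`
        have hexp : ⟪A u, n⟫_ℝ = (1 / 3) * ⟪A (slotSite 8), n⟫_ℝ - (2 / 3) * ⟪A (slotSite 0), n⟫_ℝ -
            (2 / 3) * (⟪A (slotSite 8), n⟫_ℝ - ⟪A (slotSite 2), n⟫_ℝ) := by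
          rw [hu, map_sub, map_sub, map_smul, map_smul, map_smul, slotSite_four_eq, map_sub,
            inner_sub_left, inner_sub_left, inner_smul_left, inner_smul_left, inner_smul_left, inner_sub_left]
          simp
        have hc8' : ⟪A (slotSite 8), n⟫_ℝ = 0 ∨ ⟪A (slotSite 8), n⟫_ℝ = -s := by
          rcases hmenu _ (slotSite_mem 8) with h | h | h
          · exact Or.inl h
          · linarith
          · exact Or.inr h
        rcases hmenu _ (slotSite_mem 0) with h0' | h0' | h0' <;> rcases hc8' with h8 | h8 <;>
          · rw [hexp, h0', h8, ha'] at hun; nlinarith [hs0]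
    · linarith

/-- **(L7).**  A saturated hcp run-end (module docstring) has two DISTINCT contact neighbours with at most
eleven contacts each. -/
theorem hcpRunEnd_two_unsaturated {δ : ℝ} (hg : KissingGap δ) (hc : KissingClassification δ)
    (hX : ∀ p ∈ X, ∀ q ∈ X, p ≠ q → 1 ≤ dist p q) {t : EuclideanSpace ℝ (Fin 3)}
    (h12 : (X.filter fun q => dist t q = 1).card = 12)
    (A : EuclideanSpace ℝ (Fin 3) ≃ₗᵢ[ℝ] EuclideanSpace ℝ (Fin 3))
    (haX : t + A (slotSite 2) ∈ X) (hbX : t + A (slotSite 6) ∈ X) (hcX : t + A (slotSite 8) ∈ X)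
    (hdX : t + A ((1 / 3 : ℝ) • slotSite 8 - (2 / 3 : ℝ) • slotSite 0 - (2 / 3 : ℝ) • slotSite 4) ∈ X)
    (hrun : t + A (slotSite 1) ∉ X) :
    ∃ z ∈ X, ∃ z' ∈ X, z ≠ z' ∧ dist t z = 1 ∧ dist t z' = 1 ∧
      (X.filter fun q => dist z q = 1).card ≤ 11 ∧ (X.filter fun q => dist z' q = 1).card ≤ 11 := by
  obtain ⟨z, hz, hdz, -, hcz⟩ := hcpRunEnd_exists_unsaturated hg hc hX h12 A haX hbX hcX hdX hrun t
  obtain ⟨z', hz', hdz', hne, hcz'⟩ := hcpRunEnd_exists_unsaturated hg hc hX h12 A haX hbX hcX hdX hrun z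
  exact ⟨z, hz, z', hz', hne.symm, hdz, hdz', hcz, hcz'⟩

end Summit.Ventures.Crystal3D.Theorems

end
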